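import Mathlib
import Summits.Langlands.Langlands.Theses.DyadicOddResidue
import Literature.NumberTheory.GaloisRepresentations.CrystallineOrdinary

/-!
# Sketch — crux-ideate `stmt-Langlands-18741` (DyadicEisensteinFM), ideator 2, round 1

First lemmas of the two idea cards (they only need to ELABORATE; two are proved anyway):

* Card A `thorne-dense-weight-two`: `OrdinarySlice` (the crux restricted to `ρ` crystalline-
  ordinary at the place above 2 — the half of the crux the card transfers), the sanity
  implication `ordinarySlice_of_crux`, and the commutative-algebra engine of the card,
  `nilpotent_of_forall_mem_primes_over` (Zariski-density transport through a finite/integral,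
  dominant `Λ`-algebra: an element lying in every prime above a Zariski-dense set of primes of `Λ`
  is nilpotent) — applied with `Λ = ℤ₂⟦1+4ℤ₂⟧`, `R = R^{ps,n.ord}_S`, `W` = weight-(2,χ) primes,
  `f ∈ ker (R → 𝕋^{n.ord})`.
* Card B `koch-free-product-assembly`: `LevelOneSlice` (the crux for `ρ` unramified away from 2 —
  the base case `S = {2, ∞}`, `G_{ℚ,S}(2) = ℤ/2 ∗ ℤ₂`), `levelOneSlice_of_crux`, and the 2-adic
  lifting step `bijective_of_injective_mod_two` (a surjection of rings that is injective mod 2 onto a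
  2-torsion-free ring is an isomorphism as soon as 2 lies in the Jacobson radical and the source is
  noetherian) — the step "Bellaïche's `R̄ = A = 𝔽₂⟦x,y⟧` ⇒ `R^{ps} = 𝕋₂(1)` over `ℤ₂`".
-/

namespace Summit.Langlands.Langlands.Cruxes.DyadicEisensteinFM.Sketch

open Summit.Langlands.Langlands.Theses.DyadicOddResidue
open IsDedekindDomain NumberField Filter

/-- Card A target (TRANSFER, ordinary half): the crux `DyadicEisensteinFM` restricted to `ρ`
crystalline-ordinary (Greenberg, distinct exponents) at the place of `ℚ` above `2`. -/
def OrdinarySlice : Prop :=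
  ∀ (ℓ : ℕ) [Fact ℓ.Prime], ℓ = 2 →
    ∀ (ρ : Literature.NumberTheory.GaloisRepresentations.FramedGaloisRep ℚ (PadicAlgCl ℓ) 2),
      ¬ ρ.IsResiduallyAbsIrreducible → ρ.toGaloisRep.IsIrreducible → ρ.IsOdd →
      (∀ᶠ v : HeightOneSpectrum (𝓞 ℚ) in cofinite, ρ.IsUnramifiedAt v) →
      (∀ (v : HeightOneSpectrum (𝓞 ℚ)) (hv : ((ℓ : ℕ) : 𝓞 ℚ) ∈ v.asIdeal),
        (Literature.NumberTheory.PAdicHodge.fontainePstAdicCompletion v ℓ hv).IsDeRhamFramed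
            (ρ.toLocal v) ∧
          ∀ τ : v.adicCompletion ℚ →+* PadicAlgCl ℓ, Continuous τ →
            (ρ.labelledHodgeTateWeightsAt v
              (Literature.NumberTheory.PAdicHodge.fontainePstAdicCompletion v ℓ hv).algebra
              (Literature.NumberTheory.PAdicHodge.fontainePstAdicCompletion v ℓ hv).𝔅 τ).Nodup) →
      -- the extra hypothesis of the slice: crystalline-ordinary at every place above 2
      (∀ (v : HeightOneSpectrum (𝓞 ℚ)), ((ℓ : ℕ) : 𝓞 ℚ) ∈ v.asIdeal →
        ρ.IsCrystallineOrdinaryAt ℓ v) →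
      ∀ (hcpt : Literature.NumberTheory.Automorphic.isCompact_glFiniteIntegralLevel 2 ℚ)
        (ι : PadicAlgCl ℓ ≃+* ℂ),
        ∃ π : Literature.NumberTheory.Automorphic.CuspidalAutomorphicRepData 2 ℚ hcpt,
          π.1.IsLAlgebraic ∧
            ∀ᶠ v : HeightOneSpectrum (𝓞 ℚ) in cofinite,
              Summit.Langlands.SatakeFrobCompatibleAt ι π.1 ρ v

/-- Sanity: the slice is a weakening of the crux. -/
theorem ordinarySlice_of_crux (h : DyadicEisensteinFM) : OrdinarySlice := by
  intro ℓ _ hℓ ρ hres hirr hodd hunr hdR _hord hcpt ι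
  exact h ℓ hℓ ρ hres hirr hodd hunr hdR hcpt ι

/-- Card B base case (TRANSFER, tame level one): the crux for `ρ` unramified at every place
not above `2` (`S = {2, ∞}`). -/
def LevelOneSlice : Prop :=
  ∀ (ℓ : ℕ) [Fact ℓ.Prime], ℓ = 2 →
    ∀ (ρ : Literature.NumberTheory.GaloisRepresentations.FramedGaloisRep ℚ (PadicAlgCl ℓ) 2),
      ¬ ρ.IsResiduallyAbsIrreducible → ρ.toGaloisRep.IsIrreducible → ρ.IsOdd →
      (∀ v : HeightOneSpectrum (𝓞 ℚ), ((ℓ : ℕ) : 𝓞 ℚ) ∉ v.asIdeal → ρ.IsUnramifiedAt v) →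
      (∀ (v : HeightOneSpectrum (𝓞 ℚ)) (hv : ((ℓ : ℕ) : 𝓞 ℚ) ∈ v.asIdeal),
        (Literature.NumberTheory.PAdicHodge.fontainePstAdicCompletion v ℓ hv).IsDeRhamFramed
            (ρ.toLocal v) ∧
          ∀ τ : v.adicCompletion ℚ →+* PadicAlgCl ℓ, Continuous τ →
            (ρ.labelledHodgeTateWeightsAt v
              (Literature.NumberTheory.PAdicHodge.fontainePstAdicCompletion v ℓ hv).algebra
              (Literature.NumberTheory.PAdicHodge.fontainePstAdicCompletion v ℓ hv).𝔅 τ).Nodup) →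
      ∀ (hcpt : Literature.NumberTheory.Automorphic.isCompact_glFiniteIntegralLevel 2 ℚ)
        (ι : PadicAlgCl ℓ ≃+* ℂ),
        ∃ π : Literature.NumberTheory.Automorphic.CuspidalAutomorphicRepData 2 ℚ hcpt,
          π.1.IsLAlgebraic ∧
            ∀ᶠ v : HeightOneSpectrum (𝓞 ℚ) in cofinite,
              Summit.Langlands.SatakeFrobCompatibleAt ι π.1 ρ v

/-- The places of `ℚ` above `2` form a finite set (indeed a singleton); used to turn
"unramified away from 2" into "unramified at cofinitely many places". -/
theorem finite_places_above (ℓ : ℕ) [Fact ℓ.Prime] :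
    {v : HeightOneSpectrum (𝓞 ℚ) | ((ℓ : ℕ) : 𝓞 ℚ) ∈ v.asIdeal}.Finite := by
  have hne : (Ideal.span {((ℓ : ℕ) : 𝓞 ℚ)} : Ideal (𝓞 ℚ)) ≠ ⊥ := by
    rw [Ne, Ideal.span_singleton_eq_bot]
    exact_mod_cast (Fact.out : ℓ.Prime).ne_zero
  refine (Ideal.finite_factors hne).subset ?_
  intro v hv
  simp only [Set.mem_setOf_eq] at hv ⊢
  exact (Ideal.dvd_iff_le.mpr ((Ideal.span_singleton_le_iff_mem _).mpr hv))

/-- Sanity: the level-one slice is a weakening of the crux. -/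
theorem levelOneSlice_of_crux (h : DyadicEisensteinFM) : LevelOneSlice := by
  intro ℓ _ hℓ ρ hres hirr hodd hunr hdR hcpt ι
  refine h ℓ hℓ ρ hres hirr hodd ?_ hdR hcpt ι
  rw [Filter.eventually_cofinite]
  refine (finite_places_above ℓ).subset ?_
  intro v hv
  by_contra hv'
  exact hv (hunr v hv')

/-! ### Card A engine: Zariski-density transport through a finite dominant algebra -/

/-- **Density transport.** `Λ` a domain, `R` an integral `Λ`-algebra all of whose minimal primes
contract to `⊥` (every irreducible component dominates `Spec Λ`), `W` a set of primes of `Λ` that is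
Zariski dense (`⋂ W = 0`).  Then an element of `R` lying in every prime of `R` above `W` is
nilpotent.  (Applied to `R = R^{ps,n.ord}_S → 𝕋^{n.ord}`: the kernel dies on the weight-`(2,χ)`
fibres, which are modular by Thorne 2026 Thm D, hence is nilpotent.) -/
theorem nilpotent_of_forall_mem_primes_over {Λ R : Type*} [CommRing Λ] [IsDomain Λ] [CommRing R]
    [Algebra Λ R] [Algebra.IsIntegral Λ R]
    (hdom : ∀ q ∈ minimalPrimes R, Ideal.comap (algebraMap Λ R) q = ⊥)
    (W : Set (Ideal Λ)) (hWp : ∀ P ∈ W, P.IsPrime) (hW : ∀ c : Λ, (∀ P ∈ W, c ∈ P) → c = 0)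
    (f : R) (hf : ∀ 𝔓 : Ideal R, 𝔓.IsPrime → Ideal.comap (algebraMap Λ R) 𝔓 ∈ W → f ∈ 𝔓) :
    IsNilpotent f := by
  classical
  rw [nilpotent_iff_mem_prime]
  intro p hp
  obtain ⟨q, hqmin, hqp⟩ := Ideal.exists_minimalPrimes_le (show (⊥ : Ideal R) ≤ p from bot_le)
  refine hqp ?_
  haveI hqprime : q.IsPrime := hqmin.1.1
  by_contra hfq
  -- work in the domain `S = R ⧸ q`, integral over `Λ`, into which `Λ` injects
  set S := R ⧸ q with hS
  haveI : Algebra.IsIntegral R S := Algebra.isIntegral_of_surjective Ideal.Quotient.mk_surjective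
  haveI : Algebra.IsIntegral Λ S := Algebra.IsIntegral.trans R
  have hcomp : (Ideal.Quotient.mk q).comp (algebraMap Λ R) = algebraMap Λ S := by
    rw [IsScalarTower.algebraMap_eq Λ R S, Ideal.Quotient.algebraMap_eq]
  set fb : S := Ideal.Quotient.mk q f with hfb
  have hfb0 : fb ≠ 0 := by
    rw [hfb, Ne, Ideal.Quotient.eq_zero_iff_mem]
    exact hfq
  -- a non-zero element of `Λ` inside the ideal `(f̄)`
  have hne : (Ideal.span {fb}).comap (algebraMap Λ S) ≠ ⊥ :=
    Ideal.comap_ne_bot_of_integral_mem hfb0 (Ideal.mem_span_singleton_self fb)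
      (Algebra.IsIntegral.isIntegral fb)
  obtain ⟨c, hc, hc0⟩ := Submodule.exists_mem_ne_zero_of_ne_bot hne
  refine hc0 (hW c fun P hP => ?_)
  haveI : P.IsPrime := hWp P hP
  have hker : RingHom.ker (algebraMap Λ S) ≤ P := by
    intro x hx
    have hx' : x ∈ Ideal.comap (algebraMap Λ R) q := by
      rw [Ideal.mem_comap, ← Ideal.Quotient.eq_zero_iff_mem]
      rw [RingHom.mem_ker, ← hcomp] at hx
      exact hx
    rw [hdom q hqmin, Ideal.mem_bot] at hx'
    rw [hx']
    exact P.zero_mem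
  obtain ⟨Q, hQ, hQP⟩ := Ideal.exists_ideal_over_prime_of_isIntegral_of_isDomain P hker
  have hfP : f ∈ Q.comap (Ideal.Quotient.mk q) := by
    refine hf _ (Ideal.comap_isPrime _ Q) ?_
    rw [Ideal.comap_comap, hcomp, hQP]
    exact hP
  have hfbQ : fb ∈ Q := Ideal.mem_comap.mp hfP
  have hcQ : algebraMap Λ S c ∈ Q := by
    have h1 : algebraMap Λ S c ∈ Ideal.span {fb} := Ideal.mem_comap.mp hc
    exact (Ideal.span_singleton_le_iff_mem Q |>.mpr hfbQ) h1
  have : c ∈ Q.comap (algebraMap Λ S) := Ideal.mem_comap.mpr hcQ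
  rwa [hQP] at this

/-! ### Card B lifting step: an `R = 𝕋` theorem mod 2 lifts to `ℤ₂` -/

/-- **Mod-2 isomorphisms lift.** A surjective ring map `f : R → T` from a noetherian ring in which
`2` lies in the Jacobson radical onto a `2`-torsion-free ring, which is injective modulo `2`, is
bijective.  (Nakayama on `ker f`: injectivity mod 2 gives `ker f ⊆ 2R`, torsion-freeness gives
`ker f = 2 · ker f`.)  This is the step `R̄ ≅ A = 𝔽₂⟦x,y⟧` (Bellaïche 2012, Nicolas–Serre 2012)
`⇒ R^{ps}_{(2,∞)} ≅ 𝕋₂(1)`. -/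
theorem bijective_of_injective_mod_two {R T : Type*} [CommRing R] [CommRing T] [IsNoetherianRing R]
    (f : R →+* T) (hf : Function.Surjective f) (h2 : (2 : R) ∈ (⊥ : Ideal R).jacobson)
    (hT : ∀ t : T, 2 * t = 0 → t = 0)
    (hinj : ∀ r : R, f r ∈ Ideal.span {(2 : T)} → r ∈ Ideal.span {(2 : R)}) :
    Function.Bijective f := by
  refine ⟨?_, hf⟩
  rw [RingHom.injective_iff_ker_eq_bot]
  set K : Ideal R := RingHom.ker f with hK
  -- `K ≤ 2 • K`
  have hle : K ≤ Ideal.span {(2 : R)} • K := by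
    intro k hk
    have hk0 : f k = 0 := hk
    have h2k : k ∈ Ideal.span {(2 : R)} := hinj k (by rw [hk0]; exact Ideal.zero_mem _)
    obtain ⟨r, hr⟩ := Ideal.mem_span_singleton'.mp h2k
    have hr0 : f r = 0 := by
      apply hT
      have h1 : f (r * 2) = 0 := by rw [hr]; exact hk0
      rw [map_mul, mul_comm, map_ofNat] at h1
      exact h1
    have hrK : r ∈ K := hr0
    rw [← hr, mul_comm]
    exact Ideal.mul_mem_mul (Ideal.mem_span_singleton_self _) hrK
  have hfg : K.FG := (isNoetherianRing_iff_ideal_fg R).mp ‹_› K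
  have hjac : Ideal.span {(2 : R)} ≤ (⊥ : Ideal R).jacobson := by
    rw [Ideal.span_le]; simpa using h2
  exact Submodule.eq_bot_of_le_smul_of_le_jacobson_bot (Ideal.span {(2 : R)}) K hfg hle hjac

end Summit.Langlands.Langlands.Cruxes.DyadicEisensteinFM.Sketch

/-! ### Card C first lemma: in a 2-extension of `ℚ` unramified outside `2∞` the prime `2` does not split -/

namespace Summit.Langlands.Langlands.Cruxes.DyadicEisensteinFM.Sketch

open NumberField

/-- **The decomposition group at 2 is everything.** If `K/ℚ` is Galois with Galois group a
`2`-group and `K` is unramified at every odd prime, then there is exactly one prime of `𝓞 K` above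
`2` (Frattini argument: the maximal elementary-abelian subextension lies in `ℚ(ζ₈)`, in which `2` is
totally ramified).  Consequence used by the card: every continuous `ρ : G_ℚ → GL₂(ℤ̄₂)` with
trivial residual semisimplification and unramified outside `2` satisfies `ρ(G_{ℚ₂}) = ρ(G_ℚ)`, and
complex conjugation lies in the decomposition group at `2` of the pro-2 quotient. -/
theorem unique_prime_above_two (K : Type) [Field K] [NumberField K] [IsGalois ℚ K]
    (h2 : IsPGroup 2 (K ≃ₐ[ℚ] K))
    (hunr : ∀ p : ℕ, p.Prime → p ≠ 2 → ¬ ((p : ℤ) ∣ NumberField.discr K))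
    (P Q : Ideal (𝓞 K)) [P.IsPrime] [Q.IsPrime]
    (hP : P.LiesOver (Ideal.span {(2 : ℤ)})) (hQ : Q.LiesOver (Ideal.span {(2 : ℤ)})) :
    P = Q := by
  sorry

end Summit.Langlands.Langlands.Cruxes.DyadicEisensteinFM.Sketch
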